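import Summits.AtomisticToContinuum.HydrodynamicLimit.Theorems.JParityClosureOddContactSymmetryGibbsInvariance
import Literature.MathematicalPhysics.KineticTheory.HardSphereTwoTimePressure
import HarnessLib

/-!
# The Loschmidt tagging identity (stub 1 of line `IdeatorThreeSketch` / card `loschmidt-tagging-exergy`
# for the crux `EnergyCurrentTails`, stmt-AtomisticToContinuum-9235)

Helper file of the line lead (prover-line-stmt-AtomisticToContinuum-9235-0) for the registered stub
`stub_tagging` of `Cruxes/EnergyCurrentTails/Lines/IdeatorThreeSketch.lean`.

Let `G = localGibbsLaw σ a 0 θ` be the HOMOGENEOUS canonical Gibbs law of `N + 1` hard spheres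
(constant activity `a`, zero drift, constant temperature `θ`).  Two exact symmetries of the hard-sphere
flow — STATIONARITY of `G` under every flow map `Φ_t`
(`Theorems.measurePreserving_flow_localGibbsLaw_const`, Liouville + conservation of energy) and
REVERSIBILITY `Φ_{-t} = flip ∘ Φ_t ∘ flip` a.e. (`ae_flow_flipVel_localGibbsLaw`, CIP 1994 §4.2 (2.3)),
together with the `flip`-invariance of `G` (`measurePreserving_flipVel_localGibbsLaw`) — give, for
every measurable `F ≥ 0`, every measurable EVEN one-particle velocity observable `g ≥ 0`, every time
`s` and particle `i`, the identity
`∫ F(z)·g(vᵢ(Φ_s z)) dG(z) = ∫ g(vᵢ(z))·F(flip(Φ_s z)) dG(z)`: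
"the tagged velocity law at time `s` of the evolution started from `F·G` is the time-`0` tagged law
of the EQUILIBRIUM gas re-weighted by the flipped density evaluated at time `s`".  With
`F = d(localGibbsLaw σ a₀ u₀ θ₀)/dG` the left side is the crux's integrand, particle by particle
(this is how the line's docking stub consumes it).  Proof transcribed from the ideator sketch
`Cruxes/EnergyCurrentTails/IdeatorThreeSketch.lean` (`taggingIdentity_holds`, planner-cruxidea-…-3-0).

References: C. Cercignani, R. Illner, M. Pulvirenti, *The Mathematical Theory of Dilute Gases*
(1994) §4.2 (reversibility of the hard-sphere flow); H. Spohn, *Large Scale Dynamics of Interacting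
Particles* (1991) Part I §2.3 (equilibrium measures are invariant).
-/

noncomputable section

open MeasureTheory Set Filter
open scoped ENNReal

namespace Summit.AtomisticToContinuum.HydrodynamicLimit.Theorems.LoschmidtTagging

open Literature.MathematicalPhysics.KineticTheory Literature.Analysis.FluidPDE

/-- **The Loschmidt tagging identity** (registered stub `stub_tagging` of line `IdeatorThreeSketch`,
crux stmt-AtomisticToContinuum-9235).  For the homogeneous Gibbs law `G = localGibbsLaw σ a 0 θ`,
every hard-sphere flow `Φ`, every measurable `F ≥ 0`, every measurable even `g ≥ 0`, every time `s`
and particle `i`: `∫ F(z)·g(vᵢ(Φ_s z)) dG = ∫ g(vᵢ(z))·F(flip(Φ_s z)) dG`.  Substitute `z = Φ_{-s} w`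
(invariance of `G` under the flow), cancel `Φ_s Φ_{-s}` on the good set, rewrite
`Φ_{-s} w = flip (Φ_s (flip w))` a.e., substitute `w = flip w'` (invariance of `G` under `flip`),
and use the evenness of `g`. -/
theorem stub_tagging :
    ∀ (σ a θ : ℝ) (N : ℕ)
      (Φ : HardSphereFlow (Torus.geometry (Fin 3)) (hsDiameter σ N) (N + 1))
      (F : Config (N + 1) (Fin 3) T3 → ℝ≥0∞), Measurable F →
      ∀ (g : V3 → ℝ≥0∞), Measurable g → (∀ v, g (-v) = g v) →
      ∀ (s : ℝ) (i : Fin (N + 1)),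
        ∫⁻ z, F z * g ((Φ.flow s z i).2)
            ∂(localGibbsLaw σ (fun _ => a) (fun _ => 0) (fun _ => θ) N Φ)
          = ∫⁻ z, g ((z i).2) * F (flipVel (Φ.flow s z))
              ∂(localGibbsLaw σ (fun _ => a) (fun _ => 0) (fun _ => θ) N Φ) := by
  intro σ a θ N Φ F hF g hg hgeven s i
  have hSe := measurableEmbedding_flipVel (X := T3) (d := Fin 3) (N := N + 1)
  have hR := measurePreserving_flipVel_localGibbsLaw σ (fun _ => a) (fun _ => θ) N Φ
  have hΦ := Summit.AtomisticToContinuum.HydrodynamicLimit.Theorems.measurePreserving_flow_localGibbsLaw_const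
    σ a θ (0 : V3) N Φ (-s)
  have hrev := ae_flow_flipVel_localGibbsLaw σ (fun _ => a) (fun _ => (0 : V3)) (fun _ => θ) N Φ s
  have hgood := ae_mem_good_localGibbsLaw σ (fun _ => a) (fun _ => (0 : V3)) (fun _ => θ) N Φ
  have hvel : ∀ t : ℝ, Measurable fun z : Config (N + 1) (Fin 3) T3 => (Φ.flow t z i).2 := fun t =>
    measurable_snd.comp ((measurable_pi_apply i).comp (Φ.measurable_flow t))
  have hh : Measurable fun z : Config (N + 1) (Fin 3) T3 => F z * g ((Φ.flow s z i).2) :=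
    hF.mul (hg.comp (hvel s))
  calc ∫⁻ z, F z * g ((Φ.flow s z i).2) ∂(localGibbsLaw σ (fun _ => a) (fun _ => 0) (fun _ => θ) N Φ)
      = ∫⁻ w, F (Φ.flow (-s) w) * g ((Φ.flow s (Φ.flow (-s) w) i).2)
          ∂(localGibbsLaw σ (fun _ => a) (fun _ => 0) (fun _ => θ) N Φ) := by
        rw [← lintegral_map hh (Φ.measurable_flow (-s)), hΦ.map_eq]
    _ = ∫⁻ w, F (Φ.flow (-s) w) * g ((w i).2)
          ∂(localGibbsLaw σ (fun _ => a) (fun _ => 0) (fun _ => θ) N Φ) := by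
        refine lintegral_congr_ae ?_
        filter_upwards [hgood] with w hw
        have h1 := Φ.flow_neg_flow (-s) hw
        rw [neg_neg] at h1
        rw [h1]
    _ = ∫⁻ w, F (flipVel (Φ.flow s (flipVel w))) * g ((w i).2)
          ∂(localGibbsLaw σ (fun _ => a) (fun _ => 0) (fun _ => θ) N Φ) := by
        refine lintegral_congr_ae ?_
        filter_upwards [hrev] with w hw
        rw [hw, flipVel_flipVel]
    _ = ∫⁻ w, F (flipVel (Φ.flow s (flipVel (flipVel w)))) * g (((flipVel w) i).2)
          ∂(localGibbsLaw σ (fun _ => a) (fun _ => 0) (fun _ => θ) N Φ) :=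
        (hR.lintegral_comp_emb hSe
          (fun w => F (flipVel (Φ.flow s (flipVel w))) * g ((w i).2))).symm
    _ = ∫⁻ z, g ((z i).2) * F (flipVel (Φ.flow s z))
          ∂(localGibbsLaw σ (fun _ => a) (fun _ => 0) (fun _ => θ) N Φ) := by
        refine lintegral_congr fun w => ?_
        rw [flipVel_flipVel, mul_comm]
        show g (-(w i).2) * _ = _
        rw [hgeven]

end Summit.AtomisticToContinuum.HydrodynamicLimit.Theorems.LoschmidtTagging

end
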